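import Summits.QuantumFields.YangMills.Theses.UnitScaleTilt
import Summits.QuantumFields.YangMills.Theorems.UnitScaleTiltFluctuationComparisonRegPrOneStepSubmersion
import Summits.QuantumFields.YangMills.Theorems.UnitScaleTiltFluctuationComparisonRegPrSocket
import Summits.QuantumFields.YangMills.Theorems.UnitScaleTiltFluctuationComparisonRegPrLevelCauchy
import Summits.QuantumFields.YangMills.Theorems.UnitScaleTiltFluctuationComparisonRegPrStub1Of19201
import Summits.QuantumFields.YangMills.Theorems.AlphaInputsT3AC
import HarnessLib

/-!
# Route `UnitScaleTilt` — aside crux `FluctuationComparisonRegPr` (stmt-QuantumFields-19201): **THE ROUTE DECL BY NAME FROM THE FOUR REMAINING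
# ANALYTIC STUBS OF THE v5e CUT** — `FluctuationComparisonRegPr ⟸ {lane inputs, α⁺ in the CORRECTED two-run currency `TrivRegions ∧ TwoRunLv`,
# minimiser closeness (e1), small-block supplement}`, with STUB 1 (one-step small lift) and S-E″ (level Cauchy bookkeeping) DISCHARGED BY KERNEL
# (support file `--supports stmt-QuantumFields-19201`; conditional; credits nothing to any item)

Cell `ym3-torus` (HUMAN RULING D-0037: YM₃ on T³ is ladder rung R3), seat `leafhand-qf-unitscaletilt-2` gen 0 (operator refill order
2026-08-30T22:31:52Z «skeleton-ready leaves with no prover»).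

WHY.  The registered skeleton of 19201 is `Cruxes/FluctuationComparisonRegPr/Lines/birth_v5d.lean` (sha16 4707e8c063aa0596, six stubs).  Two of its six
stubs are settled in the tree: STUB 1 `stub_oneStepSmallLift` is CLOSED (✓`ApproxLift.AnsatzT.stub_oneStepSmallLift` p490827; by-name credit on 19201
✓`Stub1Of19201.stub_oneStepSmallLift` p793404), and STUB S-E″ `stub_levelCauchyOfSchemas` is PROVED IN ITS v5e TEXT
✓`LogComparisonLevelCauchy.levelCauchyOfSchemas_lv` (p476996) — the registered v5d text consumes the two-run bundle `T3AlphaInputsACTwoRun.TwoRun`, whose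
per-polymer comparison `PolymerCauchyBgAt` carries the cut-off rate on the wrong index (FINDING-19201-SE2-scaling, fleet lead ym-ust-19201-p2 g2: the
top-level total `∝ θ(⌊K/m⌋)²·L^{(3−a)⌊K/m⌋}` is not summable for `a ≤ 2`, so the registered implication is not derivable from its hypotheses for every
`a > 0`), and the fleet's ERRATUM `T3AlphaInputsACTwoRunLevel.TwoRunLv` (rate `L^{−a(1+j)}` on the level, [King1986] Prop. 3.9 (3.73)–(3.75) p.665, plus the
block-volume clause) is the currency in which S-E″ holds.  The item went `aside` (ERRATUM v3, 2026-08-27T01:09Z) one hour after p476996 landed, so v5e was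
never registered.  THIS FILE is the v5e composition AS A THEOREM: the route decl `Theses.UnitScaleTilt.FluctuationComparisonRegPr` BY NAME from FOUR displayed
hypotheses — (L) `stub_laneInputsT3` verbatim, (A) `stub_alphaTwoRunOfLane` with its conclusion re-typed to `… ∧ TrivRegions D ∧ TwoRunLv D b₀ p₀ C68 a`
(p2's PROPOSED v5e text), (E) `stub_minimiserCauchy` verbatim, (S) `stub_logComparisonSmallBlocks` verbatim — the proof being birth_v5d §2 token for token
with `stub_levelCauchyOfSchemas ↦ levelCauchyOfSchemas_lv`, `stub_oneStepSmallLift ↦ Stub1Of19201.stub_oneStepSmallLift`, `landed_oneStepSubmersion ↦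
OneStepSubmersion.oneStepSubmersion_family` (so `posOnSmall` below is hypothesis-free; it has the statement of the tree's ✓`PosOnSmall.posOnSmall` (p1 g3,
filed under 19935) and is re-derived here through the 19201 credit so that this module's axiom closure is the standard trio).  So the aside's residue BY KERNEL is exactly {(L), (A), (E), (S)}: NODE O's (α) package at the pinned
carrier, the two-run activity comparison delivered with the datum (located, unprinted for non-abelian d = 3), the two-cut-off minimiser closeness
([Balaban1985Variational] Thm 1 per run; abelian template [King1986] §4), and the odd-`L < 7` supplement.

WHAT THIS IS NOT.  No (α) construction, no two-run estimate, no minimiser comparison, no small-block argument is asserted — all four are BINDERS; the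
theorem is CONDITIONAL (audit class `proof.conditional`) and CREDITS NOTHING to any item; no `def`, no `sorry`.  Binder (A) is an UNREGISTERED text — ★p2 g2's
PROPOSED v5e re-typing of `stub_alphaTwoRunOfLane`; the REGISTERED stub concludes the mis-scaled bundle `TwoRun`, from which the registered S-E″ text is not
derivable (FINDING-19201-SE2-scaling) — and (L), (E), (S) are the registered texts verbatim; the registry entry of 19201 (skeleton birth_v5d 4707e8c063aa0596) is
UNTOUCHED by this file (no stub is closed or re-registered here).  Item 19201 is an ASIDE of route `UnitScaleTilt`: it is NOT in the `closes` cone {19200, 20520, 19936}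
of rev 14, and the rung of record is `YM3TorusSU2Adm` ⟸ {20520, 19936} (★★OWNER WORD №221).  Honest label: no crux, no rung, no summit is proved here; rung R3 = SU(2) YM₃ on T³ — not d = 4, not infinite volume, not a mass gap, not Clay.

References: C. King, CMP 102 (1986) 649–677 [King1986] (Thm 3.4 (3.9) p.656, Prop. 3.9 pp.664–665); T. Bałaban, CMP 102 (1985) 255–275 [Balaban1985UV3]
(Thm 2 p.272, (41) p.266, (43)–(47) pp.266–267); CMP 102 (1985) 277–309 [Balaban1985Variational] (Thm 1 (8)–(10) p.279); CMP 109 (1987) 249–301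
[Balaban1987RG1] ((0.4) p.253).
-/

set_option autoImplicit false

noncomputable section

namespace Summit.QuantumFields.YangMills.Theorems.FluctuationComparisonRegPrOfFourV5e

open MeasureTheory Filter Topology
open Literature.MathematicalPhysics.QuantumFieldTheory.Balaban1983to89
open Literature.MathematicalPhysics.QuantumFieldTheory.Balaban1983to89.T3ContinuumYM3Torus
open Literature.MathematicalPhysics.QuantumFieldTheory.Balaban1983to89.T3LevelShift
open Literature.MathematicalPhysics.QuantumFieldTheory.Balaban1983to89.T3UnitLawDensityEML (ℰp measurableE_ℰp)
open Literature.MathematicalPhysics.QuantumFieldTheory.Balaban1983to89.T3UnitScaleTilt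
open Literature.MathematicalPhysics.QuantumFieldTheory.Balaban1983to89.T3RestrictedUnitDensity
open Literature.MathematicalPhysics.QuantumFieldTheory.Balaban1983to89.T3TiltDescent
open Literature.MathematicalPhysics.QuantumFieldTheory.Balaban1983to89.T3ConstrainedMinimiser
open Literature.MathematicalPhysics.QuantumFieldTheory.Balaban1983to89.T3RegularMinimiser
open Literature.MathematicalPhysics.QuantumFieldTheory.Balaban1983to89.T3PrintedRegularMinimiser
open Literature.MathematicalPhysics.QuantumFieldTheory.Balaban1983to89.T3SmallLiftHistory
open Literature.MathematicalPhysics.QuantumFieldTheory.Balaban1983to89.T3LogComparisonSocket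
open Literature.MathematicalPhysics.QuantumFieldTheory.Balaban1983to89.T3AlphaInputsAC
open Literature.MathematicalPhysics.QuantumFieldTheory.Balaban1983to89.T3AlphaInputsACTwoRun
open Literature.MathematicalPhysics.QuantumFieldTheory.Balaban1983to89.T3AlphaInputsACTwoRunLevel
open Literature.MathematicalPhysics.QuantumFieldTheory.Balaban1983to89.Missing
open Literature.MathematicalPhysics.QuantumFieldTheory.Balaban1983to89.T4Continuum

/-- **THE v2–v4 STUB-3 TEXT (`logComparisonRegPr`, 888 chars) FROM (L), (A) in the v5e currency, (E), (S)** — birth_v5d §2 with S-E″ supplied by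
✓`LogComparisonLevelCauchy.levelCauchyOfSchemas_lv`: for each `L ≥ 7`: the constants record `𝔠` (L), `ε₁, a` (A), `a₁` (E), then S-E″ at `(a, a₁)` gives
`m₀(L, ε₀)`; per family: `D, C68` with the package (hence `RepAtHeights`), `TrivRegions`, `TwoRunLv`; (E)'s `MinimiserCauchyAt`; S-E″'s `CauchyAtHeights`; then the
per-family socket ✓`LogComparisonSocket.stubBody_of_rep_of_cauchy` (p452026); odd `L < 7` is (S) verbatim.  CONDITIONAL; credits nothing.
[cite: King1986, Thm 3.4 (3.9) p.656 and Prop. 3.9 pp.664-665] -/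
theorem logComparisonRegPr_of_four
    (hLane : ∀ (L : ℕ), Odd L → 1 < L → Summit.QuantumFields.YangMills.Theorems.AlphaInputsT3AC L)
    (hA : ∀ (L : ℕ), Odd L → 7 ≤ L →
      ∀ 𝔠 : Summit.QuantumFields.Balaban3D.Proofs.Primitives.AlphaConsts L (Summit.QuantumFields.Balaban3D.Carriers.suGroupModel 2).N,
        ∃ ε₁ : ℝ, 0 < ε₁ ∧ ∃ a : ℝ, 0 < a ∧ ∀ (ε₀ : ℝ), 0 < ε₀ → ε₀ ≤ ε₁ → ∀ (b₀ p₀ : ℝ), 0 < b₀ → 2 < p₀ →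
          ∃ γ₁ : ℝ, 0 < γ₁ ∧ ∀ (F : T3Family) (γ : ℝ) (hF : F.L = L), 0 < γ → γ ≤ γ₁ →
            Summit.QuantumFields.YangMills.Theorems.AlphaInputsT3AC.Of F (hF ▸ 𝔠) →
              ∃ (D : AlphaDataT3 F γ) (C68 : ℝ),
                Literature.MathematicalPhysics.QuantumFieldTheory.Balaban1983to89.T3AlphaInputsACSchemas.AlphaInputsT3AC D b₀ p₀ ε₀ C68 ∧
                  TrivRegions D ∧ TwoRunLv D b₀ p₀ C68 a)
    (hE : ∀ (L : ℕ), Odd L → 1 < L → ∃ a₁ : ℝ, 0 < a₁ ∧ ∃ ε₁ : ℝ, 0 < ε₁ ∧ ∀ (ε₀ : ℝ), 0 < ε₀ → ε₀ ≤ ε₁ → ∀ (b₀ p₀ : ℝ), 0 < b₀ → 2 < p₀ →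
      ∃ γ₁ : ℝ, 0 < γ₁ ∧ ∀ (F : T3Family) (γ : ℝ), F.L = L → 0 < γ → γ ≤ γ₁ → MinimiserCauchyAt F γ ε₀ b₀ p₀ a₁)
    (hS : ∀ (L : ℕ), Odd L → 1 < L → L < 7 →
      ∃ ε₁ : ℝ, 0 < ε₁ ∧ ∀ (ε₀ : ℝ), 0 < ε₀ → ε₀ ≤ ε₁ → ∃ m₀ : ℕ, ∀ (m : ℕ), m₀ ≤ m → ∀ (b₀ p₀ : ℝ), 0 < b₀ → 2 < p₀ →
        ∃ γ₁ : ℝ, 0 < γ₁ ∧ ∀ (F : T3Family) (γ : ℝ), F.L = L → 0 < γ → γ ≤ γ₁ →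
          ∃ (r κ : ℕ → ℝ), Summable r ∧ (∀ K, 0 ≤ r K) ∧
            ∀ K, ∀ᵐ V ∂fieldMeasure (F.P (K / m)) 0 (Matrix.specialUnitaryGroup (Fin 2) ℂ),
              PlaqSmall (θBal F.L γ b₀ p₀ (K / m)) V →
                0 < heightDensity F γ (Nat.div_le_self K m) (histGood F ℰp (θBal F.L γ b₀ p₀) K (K / m)) V →
                0 < heightDensity F γ ((Nat.div_le_self K m).trans (Nat.le_succ K))
                      (histGood F ℰp (θBal F.L γ b₀ p₀) (K + 1) (K / m)) V →
                  |(Real.log (heightDensity F γ ((Nat.div_le_self K m).trans (Nat.le_succ K))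
                        (histGood F ℰp (θBal F.L γ b₀ p₀) (K + 1) (K / m)) V) + bgRegPr' F γ m ε₀ K V) -
                    (Real.log (heightDensity F γ (Nat.div_le_self K m) (histGood F ℰp (θBal F.L γ b₀ p₀) K (K / m)) V) + bgRegPr F γ m ε₀ K V) -
                      κ K| ≤ r K) :
    ∀ (L : ℕ), Odd L → 1 < L →
      ∃ ε₁ : ℝ, 0 < ε₁ ∧ ∀ (ε₀ : ℝ), 0 < ε₀ → ε₀ ≤ ε₁ → ∃ m₀ : ℕ, ∀ (m : ℕ), m₀ ≤ m → ∀ (b₀ p₀ : ℝ), 0 < b₀ → 2 < p₀ →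
        ∃ γ₁ : ℝ, 0 < γ₁ ∧ ∀ (F : T3Family) (γ : ℝ), F.L = L → 0 < γ → γ ≤ γ₁ →
          ∃ (r κ : ℕ → ℝ), Summable r ∧ (∀ K, 0 ≤ r K) ∧
            ∀ K, ∀ᵐ V ∂fieldMeasure (F.P (K / m)) 0 (Matrix.specialUnitaryGroup (Fin 2) ℂ),
              PlaqSmall (θBal F.L γ b₀ p₀ (K / m)) V →
                0 < heightDensity F γ (Nat.div_le_self K m) (histGood F ℰp (θBal F.L γ b₀ p₀) K (K / m)) V →
                0 < heightDensity F γ ((Nat.div_le_self K m).trans (Nat.le_succ K))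
                      (histGood F ℰp (θBal F.L γ b₀ p₀) (K + 1) (K / m)) V →
                  |(Real.log (heightDensity F γ ((Nat.div_le_self K m).trans (Nat.le_succ K))
                        (histGood F ℰp (θBal F.L γ b₀ p₀) (K + 1) (K / m)) V) + bgRegPr' F γ m ε₀ K V) -
                    (Real.log (heightDensity F γ (Nat.div_le_self K m) (histGood F ℰp (θBal F.L γ b₀ p₀) K (K / m)) V) + bgRegPr F γ m ε₀ K V) -
                      κ K| ≤ r K := by
  intro L hLo hL
  by_cases h7 : 7 ≤ L
  swap
  · exact hS L hLo hL (not_le.mp h7)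
  obtain ⟨𝔠, h𝔠⟩ := hLane L hLo hL
  obtain ⟨εa, hεa, a, ha, hA'⟩ := hA L hLo h7 𝔠
  obtain ⟨a₁, ha₁, εe, hεe, hE'⟩ := hE L hLo hL
  obtain ⟨εs, hεs, hS'⟩ :=
    Summit.QuantumFields.YangMills.Theorems.LogComparisonLevelCauchy.levelCauchyOfSchemas_lv L hLo hL a a₁ ha ha₁
  refine ⟨min εa (min εe εs), lt_min hεa (lt_min hεe hεs), fun ε₀ h0 h1 => ?_⟩
  have h1a : ε₀ ≤ εa := h1.trans (min_le_left _ _)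
  have h1e : ε₀ ≤ εe := h1.trans ((min_le_right _ _).trans (min_le_left _ _))
  have h1s : ε₀ ≤ εs := h1.trans ((min_le_right _ _).trans (min_le_right _ _))
  obtain ⟨m₀, hm₀⟩ := hS' ε₀ h0 h1s
  refine ⟨max m₀ 1, fun m hm b₀ p₀ hb hp => ?_⟩
  have hmpos : 0 < m := Nat.lt_of_lt_of_le Nat.one_pos ((le_max_right _ _).trans hm)
  obtain ⟨γa, hγa, hA''⟩ := hA' ε₀ h0 h1a b₀ p₀ hb hp
  obtain ⟨γe, hγe, hE''⟩ := hE' ε₀ h0 h1e b₀ p₀ hb hp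
  obtain ⟨γs, hγs, hS''⟩ := hm₀ m ((le_max_left _ _).trans hm) b₀ p₀ hb hp
  refine ⟨min γa (min γe γs), lt_min hγa (lt_min hγe hγs), fun F γ hF hγ hγ₁ => ?_⟩
  have hγa' : γ ≤ γa := hγ₁.trans (min_le_left _ _)
  have hγe' : γ ≤ γe := hγ₁.trans ((min_le_right _ _).trans (min_le_left _ _))
  have hγs' : γ ≤ γs := hγ₁.trans ((min_le_right _ _).trans (min_le_right _ _))
  obtain ⟨D, C68, hPkg, hTriv, hTwo⟩ := hA'' F γ hF hγ hγa' (h𝔠 F hF)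
  have hMin := hE'' F γ hF hγ hγe'
  have hCau : CauchyAtHeights D b₀ p₀ m := hS'' F γ hF hγ hγs' hMin D C68 hPkg hTriv hTwo
  exact Summit.QuantumFields.YangMills.Theorems.LogComparisonSocket.stubBody_of_rep_of_cauchy F γ b₀ p₀ ε₀ hmpos
    D.PintH D.EcstH D.RmH hPkg.repAtHeights hCau

/-- **POSITIVITY OF BOTH RESTRICTED HEIGHT DENSITIES ON THE WINDOW — HYPOTHESIS-FREE** (birth_v5d's `posOnSmall`; same statement as the tree's
✓`PosOnSmall.posOnSmall`, p1 g3 under 19935): STUB 1 is closed (✓`Stub1Of19201.stub_oneStepSmallLift`, p793404 ← p490827) and the one-step submersion is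
✓`OneStepSubmersion.oneStepSubmersion_family` (p446430); composed by ✓`PosOnSmallReduction.posOnSmall_of_smallLift_of_oneStepSubmersion` (p443013).
[cite: Balaban1987RG1, (0.4) p.253] -/
theorem posOnSmall :
    ∀ (L m : ℕ), 0 < m → ∀ (b₀ p₀ : ℝ), 0 < b₀ → 2 < p₀ → ∃ γ₁ : ℝ, 0 < γ₁ ∧
      ∀ (F : T3Family) (γ : ℝ), F.L = L → 0 < γ → γ ≤ γ₁ →
        ∀ K, ∀ᵐ V ∂fieldMeasure (F.P (K / m)) 0 (Matrix.specialUnitaryGroup (Fin 2) ℂ),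
          PlaqSmall (θBal F.L γ b₀ p₀ (K / m)) V →
            0 < heightDensity F γ (Nat.div_le_self K m) (histGood F ℰp (θBal F.L γ b₀ p₀) K (K / m)) V ∧
            0 < heightDensity F γ ((Nat.div_le_self K m).trans (Nat.le_succ K))
                  (histGood F ℰp (θBal F.L γ b₀ p₀) (K + 1) (K / m)) V :=
  Summit.QuantumFields.YangMills.Theorems.PosOnSmallReduction.posOnSmall_of_smallLift_of_oneStepSubmersion
    Summit.QuantumFields.YangMills.Theorems.Stub1Of19201.stub_oneStepSmallLift
    Summit.QuantumFields.YangMills.Theorems.OneStepSubmersion.oneStepSubmersion_family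

/-- ★★★ **`FluctuationComparisonRegPr` BY NAME ⟸ (L) lane inputs ∧ (A) α⁺ in the corrected currency `TrivRegions ∧ TwoRunLv` ∧ (E) minimiser
closeness ∧ (S) small-block supplement** — the v5e composition of aside crux stmt-QuantumFields-19201 with STUB 1 and S-E″ discharged by kernel
(birth_v5d's `FluctuationComparisonRegPr_of`, token for token, over `logComparisonRegPr_of_four` and the hypothesis-free `posOnSmall`).  CONDITIONAL on the four
displayed binders; credits nothing. [cite: King1986, Thm 3.4 (3.9) p.656; Balaban1985UV3, Thm 2 p.272] -/
theorem fluctuationComparisonRegPr_of_four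
    (hLane : ∀ (L : ℕ), Odd L → 1 < L → Summit.QuantumFields.YangMills.Theorems.AlphaInputsT3AC L)
    (hA : ∀ (L : ℕ), Odd L → 7 ≤ L →
      ∀ 𝔠 : Summit.QuantumFields.Balaban3D.Proofs.Primitives.AlphaConsts L (Summit.QuantumFields.Balaban3D.Carriers.suGroupModel 2).N,
        ∃ ε₁ : ℝ, 0 < ε₁ ∧ ∃ a : ℝ, 0 < a ∧ ∀ (ε₀ : ℝ), 0 < ε₀ → ε₀ ≤ ε₁ → ∀ (b₀ p₀ : ℝ), 0 < b₀ → 2 < p₀ →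
          ∃ γ₁ : ℝ, 0 < γ₁ ∧ ∀ (F : T3Family) (γ : ℝ) (hF : F.L = L), 0 < γ → γ ≤ γ₁ →
            Summit.QuantumFields.YangMills.Theorems.AlphaInputsT3AC.Of F (hF ▸ 𝔠) →
              ∃ (D : AlphaDataT3 F γ) (C68 : ℝ),
                Literature.MathematicalPhysics.QuantumFieldTheory.Balaban1983to89.T3AlphaInputsACSchemas.AlphaInputsT3AC D b₀ p₀ ε₀ C68 ∧
                  TrivRegions D ∧ TwoRunLv D b₀ p₀ C68 a)
    (hE : ∀ (L : ℕ), Odd L → 1 < L → ∃ a₁ : ℝ, 0 < a₁ ∧ ∃ ε₁ : ℝ, 0 < ε₁ ∧ ∀ (ε₀ : ℝ), 0 < ε₀ → ε₀ ≤ ε₁ → ∀ (b₀ p₀ : ℝ), 0 < b₀ → 2 < p₀ →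
      ∃ γ₁ : ℝ, 0 < γ₁ ∧ ∀ (F : T3Family) (γ : ℝ), F.L = L → 0 < γ → γ ≤ γ₁ → MinimiserCauchyAt F γ ε₀ b₀ p₀ a₁)
    (hS : ∀ (L : ℕ), Odd L → 1 < L → L < 7 →
      ∃ ε₁ : ℝ, 0 < ε₁ ∧ ∀ (ε₀ : ℝ), 0 < ε₀ → ε₀ ≤ ε₁ → ∃ m₀ : ℕ, ∀ (m : ℕ), m₀ ≤ m → ∀ (b₀ p₀ : ℝ), 0 < b₀ → 2 < p₀ →
        ∃ γ₁ : ℝ, 0 < γ₁ ∧ ∀ (F : T3Family) (γ : ℝ), F.L = L → 0 < γ → γ ≤ γ₁ →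
          ∃ (r κ : ℕ → ℝ), Summable r ∧ (∀ K, 0 ≤ r K) ∧
            ∀ K, ∀ᵐ V ∂fieldMeasure (F.P (K / m)) 0 (Matrix.specialUnitaryGroup (Fin 2) ℂ),
              PlaqSmall (θBal F.L γ b₀ p₀ (K / m)) V →
                0 < heightDensity F γ (Nat.div_le_self K m) (histGood F ℰp (θBal F.L γ b₀ p₀) K (K / m)) V →
                0 < heightDensity F γ ((Nat.div_le_self K m).trans (Nat.le_succ K))
                      (histGood F ℰp (θBal F.L γ b₀ p₀) (K + 1) (K / m)) V →
                  |(Real.log (heightDensity F γ ((Nat.div_le_self K m).trans (Nat.le_succ K))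
                        (histGood F ℰp (θBal F.L γ b₀ p₀) (K + 1) (K / m)) V) + bgRegPr' F γ m ε₀ K V) -
                    (Real.log (heightDensity F γ (Nat.div_le_self K m) (histGood F ℰp (θBal F.L γ b₀ p₀) K (K / m)) V) + bgRegPr F γ m ε₀ K V) -
                      κ K| ≤ r K) :
    Summit.QuantumFields.YangMills.Theses.UnitScaleTilt.FluctuationComparisonRegPr := by
  intro L
  by_cases hL : Odd L ∧ 1 < L
  · obtain ⟨ε₁, hε₁, hε⟩ := logComparisonRegPr_of_four hLane hA hE hS L hL.1 hL.2
    refine ⟨ε₁, hε₁, fun ε₀ h0 h1 => ?_⟩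
    obtain ⟨m₀, hm₀⟩ := hε ε₀ h0 h1
    refine ⟨max m₀ 1, fun m hm b₀ p₀ hb hp => ?_⟩
    have hm₀' : m₀ ≤ m := (le_max_left _ _).trans hm
    have hmpos : 0 < m := Nat.lt_of_lt_of_le Nat.one_pos ((le_max_right _ _).trans hm)
    obtain ⟨γa, hγa, ha⟩ := posOnSmall L m hmpos b₀ p₀ hb hp
    obtain ⟨γb, hγb, hb'⟩ := hm₀ m hm₀' b₀ p₀ hb hp
    refine ⟨min γa γb, lt_min hγa hγb, fun F γ hFL hγ hγ₁ => ?_⟩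
    have hP := ha F γ hFL hγ (hγ₁.trans (min_le_left _ _))
    obtain ⟨r, κ, hr, hr0, hC⟩ := hb' F γ hFL hγ (hγ₁.trans (min_le_right _ _))
    refine ⟨r, κ, hr, hr0, fun K => ?_⟩
    filter_upwards [hP K, hC K] with V hVp hVc
    intro hs
    obtain ⟨h0', h1'⟩ := hVp hs
    exact ⟨h0', h1', hVc hs h0' h1'⟩
  · refine ⟨1, one_pos, fun ε₀ _ _ => ⟨0, fun m _ b₀ p₀ _ _ => ⟨1, one_pos, fun F γ hFL _ _ => ?_⟩⟩⟩
    have hF := F.hL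
    rw [hFL] at hF
    exact (hL hF).elim

end Summit.QuantumFields.YangMills.Theorems.FluctuationComparisonRegPrOfFourV5e

end
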